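import Summits.QuantumFields.BalabanUV.Beta.D1BFx.LandauDictionaryHOps
import Summits.QuantumFields.BalabanUV.Beta.D1BFx.ProjectorGaugeBlockConst

/-!
# `BalabanUV.Beta.D1BFx.VectorLegTannery` — road «BF-x» for binder row D1, slot (K), debt X₁a, brick **Q4 part 1** of `X1-SPEC.md`:
# THE (X₁a) OPERATOR `½·curvAdj∘curv + dz∘Rf∘codiff₁ + a′·𝒬ᵀ𝒬` PASSES TO POINTWISE LIMITS OF UNIFORMLY BOUNDED 1-FORMS — finite stencils termwise,
# the gauge projector `Pf` by dominated convergence (Tannery) against the summable row of `Pgt`; plus the «identity in the limit» packaging Q4 part 2 uses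

HONEST FRAMING (cell contract, verbatim): «discharging `BetaPertH` makes Bałaban's UV stability UNCONDITIONAL — a real constructive-QFT
result; it is NOT the continuum limit and NOT the Clay problem.»  HONEST DEPENDENCY (verbatim): «continuum YM on T⁴ ⇐ BetaPertH ∧ nine
spine estimates (0/9 proved); BetaPertH ⇐ (D1) ∧ (D4) ∧ CAP+tail; G-an2-4 gates asym, D1 and NE2/3/4.»  THIS MODULE DISCHARGES NOTHING of
D1 / BetaPertH: [folklore] elementary limits (Mathlib `tendsto_tsum_of_dominated_convergence`, `tendsto_nhds_unique`) over the road's B4 operators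
`KernelFormOperators.Pf/Rf` and an2's stencils, with `ProjectorGaugeBlockConst.summable_Pgt_mul` and `LandauDictionaryHOps.abs_codiff₁_le_of_bound` BY
NAME.  No `def`, no `Prop` is minted, nothing is cited, 0 sorry.  NOT summit progress; NOT BetaPertH, NOT continuum, NOT Clay.

ABSOLUTE RULE (cell, verbatim): «No internally-minted statement may enter as a cited fact. Every hypothesis is either kernel-proved in this
package or a verbatim quotation of a PUBLISHED theorem with page reference. The manuscript(s) under audit are NOT citable for their own
disputed steps — they are the thing under adjudication; programme-internal (2001/route/tribunal) claims are never citable.»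

WHY (`HOME/b2b-balaban-beta-d1-p2/X1-SPEC.md` v1 §1 brick Q4; owner's coordination note, journal 2026-08-20T19:25Z).  X₁a (`Δ_a·Ga = δ` on `ℤ⁴` for
`Ga = Kinf`) is assembled by TANNERY ON COLUMNS: per even cubic volume `t`, an5's torus identity `DeltaA_t *ᵥ calG_t(·, ȳ_l) = δ` read on periodic lifts
(Q2 `StencilDictionaryTorus.DeltaA_mulVec_castT_hodge`, Q3c the gauge term) says that the (X₁a) operator applied to the lifted column `F_t` equals a
Kronecker delta on the torus; `F_t → Kinf(·,(y,l))/n²` pointwise (`calG_re_tendsto_Kinf`) with the volume-free bound `1/γ₀` (`abs_calG_re_le`).  This file is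
the t-independent analytic half: the operator's value at any bond is continuous along such limits (finite stencils trivially; the one infinite sum, the
gauge projector `Pf`, by dominated convergence with the summable majorant `|Pgt(p,·)|·8B`), and an identity holding eventually along the family passes to
the limit form.  No an5 object is imported here.

CONTENT (block side `n ≥ 1`, `a > 0`, any filter `𝓕`; all [folklore]).
* §1 finite stencils along pointwise limits: `tendsto_dz`, `tendsto_curv`, `tendsto_curvAdj_curv`, `tendsto_codiff₁`, `tendsto_contourSum`,
  `tendsto_contourSumAdj`, `tendsto_QtQ`.
* §2 the gauge projector: `tendsto_Pf` (Tannery), `tendsto_Rf`, `tendsto_dz_Rf_codiff₁`.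
* §3 **`tendsto_X1aOp`** (the whole operator, pointwise) and **`X1aOp_eq_of_eventually_eq`** (if the operator applied to `F_t` equals `e_t` eventually and
  `e_t → E`, then the operator applied to the limit form equals `E`).
Unit `b2b-balaban-beta-d1-p2` (road owner, gen 5).
-/

namespace Summit.QuantumFields.BalabanUV.Beta.D1BFx.VectorLegTannery

open Finset Filter Topology
open scoped BigOperators
open Literature.MathematicalPhysics.QuantumFieldTheory.Balaban1983to89
open Literature.MathematicalPhysics.QuantumFieldTheory.Balaban1983to89.Beta
open ExpKernelCalculus (Site)
open AffineAveraging (Form0 Form1 box toSite unitVec dz curv curvAdj codiff₁ contourSum)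
open AffineReproduction (contourSumAdj)
open RProjector (Pgt)
open KernelFormOperators (kerOp Pf Rf)
open ProjectorGaugeBlockConst (summable_Pgt_mul)
open LandauDictionaryHOps (abs_codiff₁_le_of_bound)

noncomputable section

variable {ι : Type*} {𝓕 : Filter ι}

/-! ## §1 Finite stencils along pointwise limits -/

section Stencils

/-- [folklore] `dz` of a pointwise convergent family of 0-forms converges pointwise. -/
theorem tendsto_dz {f : ι → Form0 4 ℝ} {g : Form0 4 ℝ} (h : ∀ w, Tendsto (fun t => f t w) 𝓕 (𝓝 (g w))) (κ : Fin 4) (x : Site 4) :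
    Tendsto (fun t => dz (f t) κ x) 𝓕 (𝓝 (dz g κ x)) := by
  simp only [dz]; exact (h _).sub (h _)

variable {F : ι → Form1 4 ℝ} {A : Form1 4 ℝ}

/-- [folklore] `curv` along pointwise limits. -/
theorem tendsto_curv (h : ∀ κ w, Tendsto (fun t => F t κ w) 𝓕 (𝓝 (A κ w))) (κ l : Fin 4) (x : Site 4) :
    Tendsto (fun t => curv (F t) κ l x) 𝓕 (𝓝 (curv A κ l x)) := by
  simp only [curv]; exact (((h _ _).add (h _ _)).sub (h _ _)).sub (h _ _)

/-- [folklore] `curvAdj ∘ curv` along pointwise limits. -/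
theorem tendsto_curvAdj_curv (h : ∀ κ w, Tendsto (fun t => F t κ w) 𝓕 (𝓝 (A κ w))) (μ : Fin 4) (y : Site 4) :
    Tendsto (fun t => curvAdj (curv (F t)) μ y) 𝓕 (𝓝 (curvAdj (curv A) μ y)) := by
  simp only [curvAdj]
  exact (tendsto_finsetSum _ fun l _ => (tendsto_curv h _ _ _).sub (tendsto_curv h _ _ _)).add
    (tendsto_finsetSum _ fun κ _ => (tendsto_curv h _ _ _).sub (tendsto_curv h _ _ _))

/-- [folklore] `codiff₁` along pointwise limits. -/
theorem tendsto_codiff₁ (h : ∀ κ w, Tendsto (fun t => F t κ w) 𝓕 (𝓝 (A κ w))) (q : Site 4) :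
    Tendsto (fun t => codiff₁ (F t) q) 𝓕 (𝓝 (codiff₁ A q)) := by
  simp only [codiff₁]; exact tendsto_finsetSum _ fun κ _ => (h _ _).sub (h _ _)

/-- [folklore] `contourSum n` along pointwise limits. -/
theorem tendsto_contourSum (n : ℕ) (h : ∀ κ w, Tendsto (fun t => F t κ w) 𝓕 (𝓝 (A κ w))) (κ : Fin 4) (y : Site 4) :
    Tendsto (fun t => contourSum n (F t) κ y) 𝓕 (𝓝 (contourSum n A κ y)) := by
  simp only [contourSum]; exact tendsto_finsetSum _ fun b _ => tendsto_finsetSum _ fun s _ => h _ _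

/-- [folklore] `contourSumAdj n` along pointwise limits of coarse 1-forms. -/
theorem tendsto_contourSumAdj (n : ℕ) {Φ : ι → Form1 4 ℝ} {φ : Form1 4 ℝ} (h : ∀ κ y, Tendsto (fun t => Φ t κ y) 𝓕 (𝓝 (φ κ y)))
    (κ : Fin 4) (x : Site 4) : Tendsto (fun t => contourSumAdj n (Φ t) κ x) 𝓕 (𝓝 (contourSumAdj n φ κ x)) := by
  simp only [contourSumAdj]; exact tendsto_finsetSum _ fun s _ => h _ _

/-- [folklore] `𝒬ᵀ𝒬` along pointwise limits. -/
theorem tendsto_QtQ (n : ℕ) (h : ∀ κ w, Tendsto (fun t => F t κ w) 𝓕 (𝓝 (A κ w))) (κ : Fin 4) (x : Site 4) :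
    Tendsto (fun t => contourSumAdj n (contourSum n (F t)) κ x) 𝓕 (𝓝 (contourSumAdj n (contourSum n A) κ x)) :=
  tendsto_contourSumAdj n (fun κ y => tendsto_contourSum n h κ y) κ x

end Stencils

/-! ## §2 The gauge projector `Pf` by dominated convergence -/

section Projector

variable (n : ℕ) [NeZero n] {a : ℝ}

/-- [folklore] **TANNERY FOR THE GAUGE PROJECTOR**: if `f_t → g` pointwise with `|f_t| ≤ B` eventually-uniformly, then `Pf n a f_t p → Pf n a g p`
(dominated convergence against the summable row `|Pgt(p, ·)|·B`). -/
theorem tendsto_Pf (ha : 0 < a) {f : ι → Form0 4 ℝ} {g : Form0 4 ℝ} {B : ℝ} (hB : ∀ᶠ t in 𝓕, ∀ q, |f t q| ≤ B)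
    (h : ∀ q, Tendsto (fun t => f t q) 𝓕 (𝓝 (g q))) (p : Site 4) :
    Tendsto (fun t => Pf n a (f t) p) 𝓕 (𝓝 (Pf n a g p)) := by
  simp only [Pf, KernelFormOperators.kerOp_apply]
  have hrow : Summable fun q : Site 4 => |Pgt n a p q () ()| * B :=
    ((summable_Pgt_mul n a ha (g := fun _ => (1 : ℝ)) (M := 1) (fun q => by simp) p).congr (fun q => by simp)).abs.mul_right B
  refine tendsto_tsum_of_dominated_convergence hrow (fun q => (h q).const_mul _) ?_
  filter_upwards [hB] with _ ht q
  rw [Real.norm_eq_abs, abs_mul]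
  exact mul_le_mul_of_nonneg_left (ht q) (abs_nonneg _)

/-- [folklore] `Rf = 1 − Pf` along such limits. -/
theorem tendsto_Rf (ha : 0 < a) {f : ι → Form0 4 ℝ} {g : Form0 4 ℝ} {B : ℝ} (hB : ∀ᶠ t in 𝓕, ∀ q, |f t q| ≤ B)
    (h : ∀ q, Tendsto (fun t => f t q) 𝓕 (𝓝 (g q))) (p : Site 4) :
    Tendsto (fun t => Rf n a (f t) p) 𝓕 (𝓝 (Rf n a g p)) := by
  simp only [Rf, Pi.sub_apply]; exact (h p).sub (tendsto_Pf n ha hB h p)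

variable {F : ι → Form1 4 ℝ} {A : Form1 4 ℝ} {B : ℝ}

/-- [folklore] **THE GAUGE TERM `dz (Rf (codiff₁ F_t))`** along uniformly bounded pointwise limits of 1-forms. -/
theorem tendsto_dz_Rf_codiff₁ (ha : 0 < a) (hB : ∀ᶠ t in 𝓕, ∀ κ w, |F t κ w| ≤ B)
    (h : ∀ κ w, Tendsto (fun t => F t κ w) 𝓕 (𝓝 (A κ w))) (κ : Fin 4) (x : Site 4) :
    Tendsto (fun t => dz (Rf n a (codiff₁ (F t))) κ x) 𝓕 (𝓝 (dz (Rf n a (codiff₁ A)) κ x)) := by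
  have hB' : ∀ᶠ t in 𝓕, ∀ q, |codiff₁ (F t) q| ≤ 8 * B := by
    filter_upwards [hB] with _ ht q using abs_codiff₁_le_of_bound ht q
  exact tendsto_dz (fun w => tendsto_Rf n ha hB' (tendsto_codiff₁ h) w) κ x

end Projector

/-! ## §3 The (X₁a) operator along limits; identities pass to the limit -/

section Main

variable (n : ℕ) [NeZero n] {a : ℝ} {F : ι → Form1 4 ℝ} {A : Form1 4 ℝ} {B : ℝ}

/-- [folklore] **THE (X₁a) OPERATOR IS CONTINUOUS ALONG UNIFORMLY BOUNDED POINTWISE LIMITS**: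
`½·curvAdj (curv F_t) + dz (Rf (codiff₁ F_t)) + a′·𝒬ᵀ𝒬 F_t → ½·curvAdj (curv A) + dz (Rf (codiff₁ A)) + a′·𝒬ᵀ𝒬 A` at every bond. -/
theorem tendsto_X1aOp (ha : 0 < a) (a' : ℝ) (hB : ∀ᶠ t in 𝓕, ∀ κ w, |F t κ w| ≤ B)
    (h : ∀ κ w, Tendsto (fun t => F t κ w) 𝓕 (𝓝 (A κ w))) (κ : Fin 4) (x : Site 4) :
    Tendsto (fun t => (1 / 2 : ℝ) * curvAdj (curv (F t)) κ x + dz (Rf n a (codiff₁ (F t))) κ x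
        + a' * contourSumAdj n (contourSum n (F t)) κ x) 𝓕
      (𝓝 ((1 / 2 : ℝ) * curvAdj (curv A) κ x + dz (Rf n a (codiff₁ A)) κ x + a' * contourSumAdj n (contourSum n A) κ x)) :=
  (((tendsto_curvAdj_curv h κ x).const_mul _).add (tendsto_dz_Rf_codiff₁ n ha hB h κ x)).add ((tendsto_QtQ n h κ x).const_mul _)

/-- [folklore] **IDENTITIES PASS TO THE LIMIT**: if, eventually along `𝓕`, the (X₁a) operator applied to `F_t` equals `e_t` at the bond `(κ, x)`, and
`e_t → E`, then it equals `E` on the limit form `A` (`𝓕` non-trivial). -/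
theorem X1aOp_eq_of_eventually_eq [NeBot 𝓕] (ha : 0 < a) (a' : ℝ) (hB : ∀ᶠ t in 𝓕, ∀ κ w, |F t κ w| ≤ B)
    (h : ∀ κ w, Tendsto (fun t => F t κ w) 𝓕 (𝓝 (A κ w))) {κ : Fin 4} {x : Site 4} {e : ι → ℝ} {E : ℝ}
    (hId : ∀ᶠ t in 𝓕, (1 / 2 : ℝ) * curvAdj (curv (F t)) κ x + dz (Rf n a (codiff₁ (F t))) κ x
        + a' * contourSumAdj n (contourSum n (F t)) κ x = e t)
    (he : Tendsto e 𝓕 (𝓝 E)) :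
    (1 / 2 : ℝ) * curvAdj (curv A) κ x + dz (Rf n a (codiff₁ A)) κ x + a' * contourSumAdj n (contourSum n A) κ x = E :=
  tendsto_nhds_unique (tendsto_X1aOp n ha a' hB h κ x) (he.congr' (hId.mono fun _ ht => ht.symm))

end Main

end

end Summit.QuantumFields.BalabanUV.Beta.D1BFx.VectorLegTannery
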